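import Mathlib.Data.Fintype.BigOperators
import Mathlib.Data.Fintype.Pi
import Mathlib.Data.Fintype.Prod
import Mathlib.Algebra.BigOperators.Ring.Finset
import Mathlib.Algebra.BigOperators.Fin
import Mathlib.Data.List.FinRange
import Mathlib.Logic.Function.Basic
import Mathlib.Data.Fin.Tuple.Basic
import HarnessLib

/-!
# Overwriting independent uniform rows at random positions preserves the uniform law

Topic `Combinatorics/Enumerative`. The hiding step of the discharge of Aaronson–Arkhipov's Thm. 1.3
(`Literature.Computability.QuantumComplexity.gpeSolvableInFBPPRel_NPRel_of_approxBosonSamplingOracle`)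
plants `n` rows `x₀, …, x_{n-1}` into an `m`-row array `r` at positions `S 0, …, S (n-1)` (later
plantings overwrite earlier ones). In the IDEAL world the planted rows are themselves fresh uniform
samples, and then the overwritten array is again uniform and independent of the positions — a pure
counting fact:

* `overwrite r S x` — the array after the plantings (a left fold of `Function.update`);
* `overwrite_succ` — peeling off the first planting;
* `sum_update_eq` — `∑_{(b, r)} g (update r s b) = |β| · ∑_{r'} g r'` (the map
  `(b, r) ↦ (r s, update r s b)` is a bijection);
* **`sum_overwrite_eq`** — `∑_{(x, r)} g (overwrite r S x) = |β|ⁿ · ∑_{w} g w` for EVERY `S`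
  (injective or not): the overwritten array, for uniform `(x, r)`, is uniform;
* **`card_overwrite_eq`** — the counting form `#{(x, r) | Q (overwrite r S x)} = |β|ⁿ #{w | Q w}`,
  and `card_overwrite_positions_eq` — jointly with the positions:
  `#{(x, S, r) | Q (overwrite r S x) S} = |β|ⁿ #{(S, w) | Q w S}`.

All proved (sums valued in a commutative semiring).

## References

* S. Aaronson, A. Arkhipov, *The computational complexity of linear optics*, Theory of Computing 9
  (2013) 143–252, proof of Thm. 1.3 (p. 194: "we could have equally well generated the pair
  `⟨X, A⟩` by first sampling `A` … and then setting `X := √m A_{S*}`").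
-/

namespace Literature.Combinatorics.Enumerative

open Finset

variable {β : Type*} {m n : ℕ}

/-- **The array after planting `x i` at position `S i` for `i = 0, …, n - 1`** (in this order; a
later planting at the same position overwrites an earlier one). [folklore] -/
def overwrite (r : Fin m → β) (S : Fin n → Fin m) (x : Fin n → β) : Fin m → β :=
  (List.finRange n).foldl (fun acc i => Function.update acc (S i) (x i)) r

/-- No planting. [folklore] -/
@[simp] theorem overwrite_zero (r : Fin m → β) (S : Fin 0 → Fin m) (x : Fin 0 → β) : overwrite r S x = r := by
  simp [overwrite]

/-- **Peeling off the first planting**: plant `x 0` at `S 0`, then the rest. [folklore] -/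
theorem overwrite_succ (r : Fin m → β) (S : Fin (n + 1) → Fin m) (x : Fin (n + 1) → β) :
    overwrite r S x = overwrite (Function.update r (S 0) (x 0)) (Fin.tail S) (Fin.tail x) := by
  unfold overwrite
  rw [List.finRange_succ, List.foldl_cons, List.foldl_map]
  rfl

variable [Fintype β] {R : Type*} [CommSemiring R]

/-- The map `(b, r) ↦ (r s, update r s b)` is a bijection of `β × (Fin m → β)` (its own inverse).
[folklore] -/
def updateEquiv (s : Fin m) : β × (Fin m → β) ≃ β × (Fin m → β) where
  toFun p := (p.2 s, Function.update p.2 s p.1)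
  invFun p := (p.2 s, Function.update p.2 s p.1)
  left_inv p := by
    obtain ⟨b, r⟩ := p
    simp
  right_inv p := by
    obtain ⟨b, r⟩ := p
    simp

/-- **`∑_{(b, r)} g (update r s b) = |β| · ∑_{r'} g r'`.** [folklore] -/
theorem sum_update_eq (s : Fin m) (g : (Fin m → β) → R) :
    ∑ p : β × (Fin m → β), g (Function.update p.2 s p.1) = Fintype.card β * ∑ r : Fin m → β, g r := by
  rw [Fintype.sum_equiv (updateEquiv s) (fun p => g (Function.update p.2 s p.1)) (fun p => g p.2)
    (fun p => rfl), Fintype.sum_prod_type]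
  simp [Finset.sum_const, Finset.card_univ]

/-- **Overwriting uniform rows with uniform rows is uniform**, for every choice of positions:
`∑_{(x, r)} g (overwrite r S x) = |β|ⁿ · ∑_{w} g w`. [cite: AaronsonArkhipovToC2013, proof of Thm. 1.3 (p. 194)] -/
theorem sum_overwrite_eq :
    ∀ {n : ℕ} (S : Fin n → Fin m) (g : (Fin m → β) → R),
      ∑ p : (Fin n → β) × (Fin m → β), g (overwrite p.2 S p.1) = (Fintype.card β : R) ^ n * ∑ w : Fin m → β, g w
  | 0, S, g => by
    rw [Fintype.sum_prod_type]
    simp [overwrite_zero, Finset.sum_const]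
  | n + 1, S, g => by
    -- split `x = Fin.cons (x 0) (Fin.tail x)`
    have hsplit : ∑ p : (Fin (n + 1) → β) × (Fin m → β), g (overwrite p.2 S p.1) =
        ∑ q : (β × (Fin n → β)) × (Fin m → β),
          g (overwrite (Function.update q.2 (S 0) q.1.1) (Fin.tail S) q.1.2) := by
      refine (Fintype.sum_equiv ((Fin.consEquiv fun _ => β).prodCongr (Equiv.refl _))
        (fun q => g (overwrite (Function.update q.2 (S 0) q.1.1) (Fin.tail S) q.1.2))
        (fun p => g (overwrite p.2 S p.1)) (fun q => ?_)).symm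
      obtain ⟨⟨b, x'⟩, r⟩ := q
      simp only [Equiv.prodCongr_apply, Prod.map_apply, Equiv.refl_apply]
      rw [overwrite_succ]
      congr 2
    rw [hsplit, Fintype.sum_prod_type, Fintype.sum_prod_type]
    have hinner : ∀ x' : Fin n → β,
        ∑ b : β, ∑ r : Fin m → β, g (overwrite (Function.update r (S 0) b) (Fin.tail S) x') =
          Fintype.card β * ∑ r' : Fin m → β, g (overwrite r' (Fin.tail S) x') := by
      intro x'
      rw [← Fintype.sum_prod_type', sum_update_eq (S 0) (fun r' => g (overwrite r' (Fin.tail S) x'))]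
    calc ∑ b : β, ∑ x' : Fin n → β, ∑ r : Fin m → β, g (overwrite (Function.update r (S 0) b) (Fin.tail S) x')
        = ∑ x' : Fin n → β, ∑ b : β, ∑ r : Fin m → β, g (overwrite (Function.update r (S 0) b) (Fin.tail S) x') :=
          Finset.sum_comm
      _ = ∑ x' : Fin n → β, (Fintype.card β : R) * ∑ r' : Fin m → β, g (overwrite r' (Fin.tail S) x') :=
          Finset.sum_congr rfl fun x' _ => hinner x'
      _ = Fintype.card β * ∑ p : (Fin n → β) × (Fin m → β), g (overwrite p.2 (Fin.tail S) p.1) := by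
          rw [← Finset.mul_sum, Fintype.sum_prod_type]
      _ = (Fintype.card β : R) ^ (n + 1) * ∑ w : Fin m → β, g w := by
          rw [sum_overwrite_eq (Fin.tail S) g, ← mul_assoc, pow_succ']

/-- **Counting form**: `#{(x, r) | Q (overwrite r S x)} = |β|ⁿ · #{w | Q w}`. [folklore] -/
theorem card_overwrite_eq (S : Fin n → Fin m) (Q : (Fin m → β) → Prop) [DecidablePred Q] :
    (univ.filter fun p : (Fin n → β) × (Fin m → β) => Q (overwrite p.2 S p.1)).card =
      Fintype.card β ^ n * (univ.filter Q).card := by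
  have h := sum_overwrite_eq (β := β) (R := ℕ) S (fun w => if Q w then (1 : ℕ) else 0)
  rw [Finset.card_filter, Finset.card_filter]
  simpa using h

/-- **Jointly with the positions**: `#{(x, S, r) | Q (overwrite r S x) S} = |β|ⁿ · #{(S, w) | Q w S}` —
for uniform `(x, S, r)` the pair `(overwritten array, positions)` is uniform; in particular the array
is independent of the positions. [cite: AaronsonArkhipovToC2013, proof of Thm. 1.3 (p. 194)] -/
theorem card_overwrite_positions_eq (Q : (Fin m → β) → (Fin n → Fin m) → Prop) [∀ w S, Decidable (Q w S)] :
    (univ.filter fun p : (Fin n → β) × (Fin n → Fin m) × (Fin m → β) => Q (overwrite p.2.2 p.2.1 p.1) p.2.1).card =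
      Fintype.card β ^ n * (univ.filter fun q : (Fin n → Fin m) × (Fin m → β) => Q q.2 q.1).card := by
  rw [Finset.card_filter, Finset.card_filter]
  -- reindex the triple `(x, S, r)` as `(S, (x, r))`
  let e : (Fin n → Fin m) × ((Fin n → β) × (Fin m → β)) ≃ (Fin n → β) × (Fin n → Fin m) × (Fin m → β) :=
    ⟨fun t => (t.2.1, t.1, t.2.2), fun p => (p.2.1, p.1, p.2.2), fun _ => rfl, fun _ => rfl⟩
  rw [← Fintype.sum_equiv e (fun t => if Q (overwrite t.2.2 t.1 t.2.1) t.1 then 1 else 0)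
      (fun p => if Q (overwrite p.2.2 p.2.1 p.1) p.2.1 then 1 else 0) (fun _ => rfl),
    Fintype.sum_prod_type,
    Fintype.sum_prod_type (f := fun q : (Fin n → Fin m) × (Fin m → β) => if Q q.2 q.1 then 1 else 0),
    Finset.mul_sum]
  refine Finset.sum_congr rfl fun S _ => ?_
  dsimp only
  have h := sum_overwrite_eq (β := β) (R := ℕ) S (fun w => if Q w S then (1 : ℕ) else 0)
  simpa using h

end Literature.Combinatorics.Enumerative
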